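import Summits.KontsevichZagierPeriods.KontsevichZagierPeriods.Theorems.LinRedNormalFormArrangementNormalFormSeparateThreeFat
import Summits.KontsevichZagierPeriods.KontsevichZagierPeriods.Theorems.LinRedNormalFormArrangementNormalFormSeparateThreeGrid
import Summits.KontsevichZagierPeriods.KontsevichZagierPeriods.Theorems.LinRedNormalFormArrangementNormalFormSeparateThreeThin

/-!
# `stub_separateThreeZero` modulo `hHI₃`: the cancellation induction and the assembly
(part `Cancel`)

(Line `janus-bands`, crux `ArrangementNormalForm`, stub `stub_separateThreeZero` — fibre-free
separation over a bounded rational polytope in `ℝ³`, `JJ 3 0 → closure (GG 2 1 0)`; part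
`Cancel`, registered as `separateThree_cancel`.)

* `SepThree.cancel`: the grid theorem `SepThree.grid` WITHOUT its thinness hypothesis — by
  strong induction on the total multiplicity `∑ e_j`: if some active `y`-letter has fat contact
  with the closed cell, it divides the numerator (`SepThree.fat_cancel`) and one power of it is
  cancelled (same cell, same letters, multiplicity lowered, the integrand unchanged on the open
  cell where the letter does not vanish); otherwise all contacts are thin and `SepThree.grid`
  applies (reference set = the closed cell itself).
* `separateThreeZero_of_hI3`: the registered stub `stub_separateThreeZero` with its EXACT binders
  plus the single hypothesis `hHI₃` (= the registered statement of `separateThree_hI`,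
  universally closed): `separateHigh_fan_active`, base change along the direction of each fan
  piece (`separatePos_baseChange`, `SepHigh.dirAinv`), `SepThree.cancel`.
-/

noncomputable section

open Set MeasureTheory Filter Topology

namespace Summit.KontsevichZagierPeriods.ArrangementNormalForm.JanusBands

open Literature.NumberTheory.Transcendental

namespace SepThree

open SeparatePos SepHigh MvPolynomial

/-- Cancelling one power of a letter in the letter block. -/
theorem prod_pow_update {m : ℕ} (u : Fin m → ℝ) (e : Fin m → ℕ) (j : Fin m) (hj : e j ≠ 0) :
    ∏ i, u i ^ e i = u j * ∏ i, u i ^ Function.update e j (e j - 1) i := by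
  classical
  obtain ⟨n, hn⟩ := Nat.exists_eq_succ_of_ne_zero hj
  have h1 : (fun i => u i ^ Function.update e j (e j - 1) i) =
      Function.update (fun i => u i ^ e i) j (u j ^ (e j - 1)) := by
    funext i
    by_cases hij : i = j
    · subst hij; simp
    · simp [Function.update_of_ne hij]
  rw [h1, Finset.prod_update_of_mem (Finset.mem_univ j), Finset.sdiff_singleton_eq_erase,
    ← Finset.mul_prod_erase Finset.univ (fun i => u i ^ e i) (Finset.mem_univ j), hn,
    Nat.succ_sub_one, pow_succ]
  ring

/-- **The cancellation induction**: `SepThree.grid` without thinness; see the module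
docstring. -/
theorem cancel
    (hHI₃ : ∀ (b k m m' n : ℕ) (s : KZ.IntegralRep (b + 1 + k)) (M : Fin m' → (Fin (b + 1) → ℚ) × ℚ) (L : Fin m → (Fin b → ℚ) × ℚ) (e : Fin m → ℕ) (p : MvPolynomial (Fin (b + 1)) ℚ) (ℓ : (Fin b → ℚ) × ℚ) (a : Fin k → Option ((Fin (b + 1) → ℚ) × ℚ)) (lo hi : Fin k → Fin k ⊕ ((Fin (b + 1) → ℚ) × ℚ)) (hpole : n ≠ 0 → ∀ z ∈ s.domain, (z (Fin.castAdd k (Fin.last b)) - (∑ i, (ℓ.1 i : ℝ) * z (Fin.castAdd k (Fin.castSucc i)) + (ℓ.2 : ℝ))) ≠ 0) (hbd : Bornology.IsBounded s.domain) (hdom : s.domain = {z | (∀ j, 0 < ∑ i, ((M j).1 i : ℝ) * z (Fin.castAdd k i) + ((M j).2 : ℝ)) ∧ ∀ i, Sum.elim (fun j => z (Fin.natAdd (b + 1) j)) (fun c => ∑ i', (c.1 i' : ℝ) * z (Fin.castAdd k i') + (c.2 : ℝ)) (lo i) < z (Fin.natAdd (b + 1) i) ∧ z (Fin.natAdd (b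 + 1) i) < Sum.elim (fun j => z (Fin.natAdd (b + 1) j)) (fun c => ∑ i', (c.1 i' : ℝ) * z (Fin.castAdd k i') + (c.2 : ℝ)) (hi i)}) (hint : EqOn s.integrand (fun z => MvPolynomial.aeval (fun i => z (Fin.castAdd k i)) p / (∏ j, (∑ i, ((L j).1 i : ℝ) * z (Fin.castAdd k (Fin.castSucc i)) + ((L j).2 : ℝ)) ^ e j) * (1 / (z (Fin.castAdd k (Fin.last b)) - (∑ i, (ℓ.1 i : ℝ) * z (Fin.castAdd k (Fin.castSucc i)) + (ℓ.2 : ℝ))) ^ n) * ∏ i, (a i).elim 1 (fun c => 1 / (z (Fin.natAdd (b + 1) i) - (∑ i', (c.1 i' : ℝ) * z (Fin.castAdd k i') + (c.2 : ℝ))))) s.domain) (N : ℕ) (q : ℕ → MvPolynomial (Fin b) ℚ) (hq : ∀ z : Fin (b + 1 + k) → ℝ, MvPolynomial.aeval (fun i => z (Fin.castAdd k i)) p = ∑ i ∈ Finset.range N, MvPolynomial.aeval (fun i => z (Fin.castAdd k (Fin.castSucc i))) (q i) * (z (Fin.castAdd k (Fin.last b)) - (∑ i, (ℓ.1 i : ℝ)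 * z (Fin.castAdd k (Fin.castSucc i)) + (ℓ.2 : ℝ))) ^ i) (hb : b = 2) (hk : k = 0) (hR : ∀ z ∈ closure s.domain, (∃ j, e j ≠ 0 ∧ (∑ i, ((L j).1 i : ℝ) * z (Fin.castAdd k (Fin.castSucc i)) + ((L j).2 : ℝ)) = 0) → (n ≠ 0 ∧ z (Fin.castAdd k (Fin.last b)) = ∑ i, (ℓ.1 i : ℝ) * z (Fin.castAdd k (Fin.castSucc i)) + (ℓ.2 : ℝ)) ∨ (∃ z' ∈ closure s.domain, z' ≠ z ∧ ∀ i : Fin b, z' (Fin.castAdd k (Fin.castSucc i)) = z (Fin.castAdd k (Fin.castSucc i)))), ∀ i ∈ Finset.range N, IntegrableOn (fun z => MvPolynomial.aeval (fun i => z (Fin.castAdd k (Fin.castSucc i))) (q i) / (∏ j, (∑ i, ((L j).1 i : ℝ) * z (Fin.castAdd k (Fin.castSucc i)) + ((L j).2 : ℝ)) ^ e j) * ((z (Fin.castAdd k (Fin.last b)) - (∑ i, (ℓ.1 i : ℝ) * z (Fin.castAdd k (Fin.castSucc i)) + (ℓ.2 : ℝ))) ^ i / (z (Fin.castAdd k (Fin.last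 b)) - (∑ i, (ℓ.1 i : ℝ) * z (Fin.castAdd k (Fin.castSucc i)) + (ℓ.2 : ℝ))) ^ n) * ∏ i, (a i).elim 1 (fun c => 1 / (z (Fin.natAdd (b + 1) i) - (∑ i', (c.1 i' : ℝ) * z (Fin.castAdd k i') + (c.2 : ℝ))))) s.domain)
    {m m' : ℕ} (s : KZ.IntegralRep (2 + 1 + 0))
    (M : Fin m' → (Fin (2 + 1) → ℚ) × ℚ) (L : Fin m → (Fin (2 + 1) → ℚ) × ℚ)
    (a : Fin 0 → Option ((Fin (2 + 1) → ℚ) × ℚ)) (lo hi : Fin 0 → Fin 0 ⊕ ((Fin (2 + 1) → ℚ) × ℚ))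
    (hbd : Bornology.IsBounded s.domain) (hdom : s.domain = gDom 2 0 m' M lo hi) (N : ℕ) :
    ∀ (e : Fin m → ℕ) (p : MvPolynomial (Fin (2 + 1)) ℚ), ∑ j, e j = N →
    EqOn s.integrand (fun z => MvPolynomial.aeval (fun i => z (Fin.castAdd 0 i)) p /
      (∏ j, affF 2 0 (L j) z ^ e j) * SeparatePos.fib 2 0 a z) s.domain →
    (∀ j, e j ≠ 0 → (L j).1 ≠ 0 → (L j).1 (Fin.last 2) ≠ 0) →
    (∀ j, (L j).1 (Fin.last 2) ≠ 0 → e j ≠ 0 → ∀ z ∈ s.domain, affF 2 0 (L j) z ≠ 0) →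
    (∀ j j', (L j).1 (Fin.last 2) ≠ 0 → (L j').1 (Fin.last 2) ≠ 0 → e j ≠ 0 → e j' ≠ 0 →
      (L j').1 (Fin.last 2) • L j ≠ (L j).1 (Fin.last 2) • L j' → ∃ C : ℝ, ∀ z ∈ s.domain,
      |affF 2 0 (L j') z| ≤ C * |((L j).1 (Fin.last 2) : ℝ) * affF 2 0 (L j') z -
        ((L j').1 (Fin.last 2) : ℝ) * affF 2 0 (L j) z|) →
    ∃ c ∈ AddSubgroup.closure (GGset 2 1 0), KZ.of s - c ∈ KZ.relations := by
  classical
  induction N using Nat.strong_induction_on with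
  | _ N ih =>
  intro e p hN hint hact hpole hrat
  -- a vanishing active letter makes the integrand zero
  by_cases hL : ∃ j, e j ≠ 0 ∧ L j = 0
  · obtain ⟨j, hej, hLj⟩ := hL
    refine ⟨0, zero_mem _, ?_⟩
    rw [sub_zero]
    refine KZ.of_mem_relations_of_eqOn_zero s fun z hz => ?_
    rw [hint hz]
    have h0 : affF 2 0 (L j) z ^ e j = 0 := by
      rw [hLj]; simp [affF, zero_pow hej]
    simp only [Pi.zero_apply]
    rw [Finset.prod_eq_zero (Finset.mem_univ j) h0, div_zero, zero_mul]
  push Not at hL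
  -- every active letter is non-zero on the open cell
  have hnz : ∀ i, e i ≠ 0 → ∀ z ∈ s.domain, affF 2 0 (L i) z ≠ 0 := by
    intro i hei z hz
    by_cases hαi : (L i).1 (Fin.last 2) = 0
    · have hlin : (L i).1 = 0 := by
        by_contra h; exact hact i hei h hαi
      have hc2 : (L i).2 ≠ 0 := fun h => hL i hei (Prod.ext hlin h)
      have : affF 2 0 (L i) z = ((L i).2 : ℝ) := by
        simp [affF, hlin]
      rw [this]
      exact_mod_cast hc2
    · exact hpole i hαi hei z hz
  -- thin or fat
  by_cases hthin : ∀ j, (L j).1 (Fin.last 2) ≠ 0 → e j ≠ 0 → ∃ P u : Fin (2 + 1 + 0) → ℝ,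
      ∀ z ∈ closure s.domain, affF 2 0 (L j) z = 0 → ∃ t : ℝ, z = P + t • u
  · exact grid hHI₃ s M L e p a lo hi hbd hdom hint hact hpole hrat (closure s.domain) subset_rfl
      hthin
  · obtain ⟨j, hj⟩ := not_forall.1 hthin
    obtain ⟨hα, hj⟩ := Classical.not_imp.1 hj
    obtain ⟨hej, hfat⟩ := Classical.not_imp.1 hj
    obtain ⟨p₁, hp₁⟩ := fat_cancel s M L e p a lo hi hbd hdom hint hnz j hej hα hfat
    -- cancel one power of the letter `j`
    set e' : Fin m → ℕ := Function.update e j (e j - 1) with he'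
    have hsum : ∑ i, e' i = N - 1 := by
      rw [he', Finset.sum_update_of_mem (Finset.mem_univ _)]
      have h1 := Finset.sum_eq_add_sum_sdiff_singleton_of_mem (Finset.mem_univ j) e
      omega
    have hlt : N - 1 < N := by
      have : 0 < N := by
        rw [← hN]
        exact Finset.sum_pos' (fun i _ => Nat.zero_le _) ⟨j, Finset.mem_univ _, Nat.pos_of_ne_zero hej⟩
      omega
    have he'e : ∀ i, e' i ≠ 0 → e i ≠ 0 := fun i => ne_zero_of_update_ne_zero
    refine ih (N - 1) hlt e' p₁ hsum (fun z hz => ?_) (fun i hi => hact i (he'e i hi))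
      (fun i hαi hi => hpole i hαi (he'e i hi))
      (fun i i' hαi hαi' hi hi' => hrat i i' hαi hαi' (he'e i hi) (he'e i' hi'))
    rw [hint hz]
    simp only []
    rw [hp₁ z, prod_pow_update (fun i => affF 2 0 (L i) z) e j hej,
      mul_div_mul_left _ _ (hnz j hej z hz)]

end SepThree

open SeparatePos SepHigh SepThree in
/-- **`stub_separateThreeZero` modulo `hHI₃`** (the registered stub with its exact binders,
plus the single hypothesis `hHI₃` = the registered statement of `separateThree_hI`, universally
closed): every absolutely convergent `[D, P/∏ L_j^{e_j}]` over a bounded rational polytope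
`D ⊂ ℝ³` is congruent modulo `KZ.relations` to a `ℤ`-combination of SEPARATED data
(`GG 2 1 0`). See the module docstring and part `Induction` for the design of the 3-d engine. -/
theorem separateThreeZero_of_hI3 (JJ : ℕ → ℕ → Set KZ.FormalRep) (GG : ℕ → ℕ → ℕ → Set KZ.FormalRep) (hJJ : ∀ b k, JJ b k = {w : KZ.FormalRep | ∃ (m m' : ℕ) (s : KZ.IntegralRep (b + k)) (M : Fin m' → (Fin b → ℚ) × ℚ) (L : Fin m → (Fin b → ℚ) × ℚ) (e : Fin m → ℕ) (p : MvPolynomial (Fin b) ℚ) (a : Fin k → Option ((Fin b → ℚ) × ℚ)) (lo hi : Fin k → Fin k ⊕ ((Fin b → ℚ) × ℚ)), Bornology.IsBounded s.domain ∧ s.domain = {z | (∀ j, 0 < ∑ i, ((M j).1 i : ℝ) * z (Fin.castAdd k i) + ((M j).2 : ℝ)) ∧ ∀ i, Sum.elim (fun j => z (Fin.natAdd b j)) (fun c => ∑ i', (c.1 i' : ℝ) * z (Fin.castAdd k i') + (c.2 : ℝ)) (lo i) < z (Fin.natAdd b i) ∧ z (Fin.natAdd b i) < Sum.elim (fun j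 => z (Fin.natAdd b j)) (fun c => ∑ i', (c.1 i' : ℝ) * z (Fin.castAdd k i') + (c.2 : ℝ)) (hi i)} ∧ EqOn s.integrand (fun z => MvPolynomial.aeval (fun i => z (Fin.castAdd k i)) p / (∏ j, (∑ i, ((L j).1 i : ℝ) * z (Fin.castAdd k i) + ((L j).2 : ℝ)) ^ e j) * ∏ i, (a i).elim 1 (fun c => 1 / (z (Fin.natAdd b i) - (∑ i', (c.1 i' : ℝ) * z (Fin.castAdd k i') + (c.2 : ℝ))))) s.domain ∧ w = KZ.of s}) (hGG : ∀ b σ k, GG b σ k = {w : KZ.FormalRep | ∃ (m m' n₁ n₂ : ℕ) (s : KZ.IntegralRep (b + 1 + k)) (M : Fin m' → (Fin (b + 1) → ℚ) × ℚ) (L : Fin m → (Fin b → ℚ) × ℚ) (e : Fin m → ℕ) (p : MvPolynomial (Fin b) ℚ) (ℓ₁ ℓ₂ : (Fin b → ℚ) × ℚ) (a : Fin k → Option ((Fin (b + 1) → ℚ) × ℚ)) (lo hi : Fin k → Fin k ⊕ ((Fin (b + 1) → ℚ) × ℚ)), (n₁ = 0 ∨ n₂ = 0) ∧ (σ = 2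 → (∀ i c, a i = some c → c.1 (Fin.last b) = 0) ∧ (∀ i c, (lo i = Sum.inr c ∨ hi i = Sum.inr c) → (c.1 (Fin.last b) = 0 ∨ c = (Pi.single (Fin.last b) 1, 0)))) ∧ Bornology.IsBounded s.domain ∧ s.domain = {z | (∀ j, 0 < ∑ i, ((M j).1 i : ℝ) * z (Fin.castAdd k i) + ((M j).2 : ℝ)) ∧ ∀ i, Sum.elim (fun j => z (Fin.natAdd (b + 1) j)) (fun c => ∑ i', (c.1 i' : ℝ) * z (Fin.castAdd k i') + (c.2 : ℝ)) (lo i) < z (Fin.natAdd (b + 1) i) ∧ z (Fin.natAdd (b + 1) i) < Sum.elim (fun j => z (Fin.natAdd (b + 1) j)) (fun c => ∑ i', (c.1 i' : ℝ) * z (Fin.castAdd k i') + (c.2 : ℝ)) (hi i)} ∧ EqOn s.integrand (fun z => MvPolynomial.aeval (fun i => z (Fin.castAdd k (Fin.castSucc i))) p / (∏ j, (∑ i, ((L j).1 i : ℝ) * z (Fin.castAdd k (Fin.castSucc i)) + ((L j).2 : ℝ)) ^ e j) * ((z (Fin.castAdd k (Fin.last b)) - (∑ i, (ℓ₁.1 i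 : ℝ) * z (Fin.castAdd k (Fin.castSucc i)) + (ℓ₁.2 : ℝ))) ^ n₁ / (z (Fin.castAdd k (Fin.last b)) - (∑ i, (ℓ₂.1 i : ℝ) * z (Fin.castAdd k (Fin.castSucc i)) + (ℓ₂.2 : ℝ))) ^ n₂) * ∏ i, (a i).elim 1 (fun c => 1 / (z (Fin.natAdd (b + 1) i) - (∑ i', (c.1 i' : ℝ) * z (Fin.castAdd k i') + (c.2 : ℝ))))) s.domain ∧ w = KZ.of s}) (hHI₃ : ∀ (b k m m' n : ℕ) (s : KZ.IntegralRep (b + 1 + k)) (M : Fin m' → (Fin (b + 1) → ℚ) × ℚ) (L : Fin m → (Fin b → ℚ) × ℚ) (e : Fin m → ℕ) (p : MvPolynomial (Fin (b + 1)) ℚ) (ℓ : (Fin b → ℚ) × ℚ) (a : Fin k → Option ((Fin (b + 1) → ℚ) × ℚ)) (lo hi : Fin k → Fin k ⊕ ((Fin (b + 1) → ℚ) × ℚ)) (hpole : n ≠ 0 → ∀ z ∈ s.domain, (z (Fin.castAdd k (Fin.last b)) - (∑ i, (ℓ.1 i : ℝ) * z (Fin.castAdd k (Fin.castSucc i)) +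 (ℓ.2 : ℝ))) ≠ 0) (hbd : Bornology.IsBounded s.domain) (hdom : s.domain = {z | (∀ j, 0 < ∑ i, ((M j).1 i : ℝ) * z (Fin.castAdd k i) + ((M j).2 : ℝ)) ∧ ∀ i, Sum.elim (fun j => z (Fin.natAdd (b + 1) j)) (fun c => ∑ i', (c.1 i' : ℝ) * z (Fin.castAdd k i') + (c.2 : ℝ)) (lo i) < z (Fin.natAdd (b + 1) i) ∧ z (Fin.natAdd (b + 1) i) < Sum.elim (fun j => z (Fin.natAdd (b + 1) j)) (fun c => ∑ i', (c.1 i' : ℝ) * z (Fin.castAdd k i') + (c.2 : ℝ)) (hi i)}) (hint : EqOn s.integrand (fun z => MvPolynomial.aeval (fun i => z (Fin.castAdd k i)) p / (∏ j, (∑ i, ((L j).1 i : ℝ) * z (Fin.castAdd k (Fin.castSucc i)) + ((L j).2 : ℝ)) ^ e j) * (1 / (z (Fin.castAdd k (Fin.last b)) - (∑ i, (ℓ.1 i : ℝ) * z (Fin.castAdd k (Fin.castSucc i)) + (ℓ.2 : ℝ))) ^ n) * ∏ i, (a i).elim 1 (fun c => 1 / (z (Fin.natAdd (b + 1) i) -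 (∑ i', (c.1 i' : ℝ) * z (Fin.castAdd k i') + (c.2 : ℝ))))) s.domain) (N : ℕ) (q : ℕ → MvPolynomial (Fin b) ℚ) (hq : ∀ z : Fin (b + 1 + k) → ℝ, MvPolynomial.aeval (fun i => z (Fin.castAdd k i)) p = ∑ i ∈ Finset.range N, MvPolynomial.aeval (fun i => z (Fin.castAdd k (Fin.castSucc i))) (q i) * (z (Fin.castAdd k (Fin.last b)) - (∑ i, (ℓ.1 i : ℝ) * z (Fin.castAdd k (Fin.castSucc i)) + (ℓ.2 : ℝ))) ^ i) (hb : b = 2) (hk : k = 0) (hR : ∀ z ∈ closure s.domain, (∃ j, e j ≠ 0 ∧ (∑ i, ((L j).1 i : ℝ) * z (Fin.castAdd k (Fin.castSucc i)) + ((L j).2 : ℝ)) = 0) → (n ≠ 0 ∧ z (Fin.castAdd k (Fin.last b)) = ∑ i, (ℓ.1 i : ℝ) * z (Fin.castAdd k (Fin.castSucc i)) + (ℓ.2 : ℝ)) ∨ (∃ z' ∈ closure s.domain, z' ≠ z ∧ ∀ i : Fin b, z' (Fin.castAdd k (Fin.castSucc i)) = z (Fin.castAdd k (Fin.castSucc i)))),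 ∀ i ∈ Finset.range N, IntegrableOn (fun z => MvPolynomial.aeval (fun i => z (Fin.castAdd k (Fin.castSucc i))) (q i) / (∏ j, (∑ i, ((L j).1 i : ℝ) * z (Fin.castAdd k (Fin.castSucc i)) + ((L j).2 : ℝ)) ^ e j) * ((z (Fin.castAdd k (Fin.last b)) - (∑ i, (ℓ.1 i : ℝ) * z (Fin.castAdd k (Fin.castSucc i)) + (ℓ.2 : ℝ))) ^ i / (z (Fin.castAdd k (Fin.last b)) - (∑ i, (ℓ.1 i : ℝ) * z (Fin.castAdd k (Fin.castSucc i)) + (ℓ.2 : ℝ))) ^ n) * ∏ i, (a i).elim 1 (fun c => 1 / (z (Fin.natAdd (b + 1) i) - (∑ i', (c.1 i' : ℝ) * z (Fin.castAdd k i') + (c.2 : ℝ))))) s.domain) : ∀ x ∈ JJ 3 0, ∃ c ∈ AddSubgroup.closure (GG 2 1 0), x - c ∈ KZ.relations := by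
  classical
  intro x hx
  rw [hJJ] at hx
  obtain ⟨m, m', s, M, L, e, p, a, lo, hi, hbd, hdom, hint, rfl⟩ := hx
  rw [show GG 2 1 0 = GGset 2 1 0 from hGG 2 1 0]
  obtain ⟨c, hc, hrel⟩ := separateHigh_fan_active 1 0 m m' s M L e p a lo hi hbd hdom hint
  -- it suffices to treat one fan piece
  suffices hpiece : ∀ w ∈ {w : KZ.FormalRep | ∃ (m₁ : ℕ) (M₁ : Fin m₁ → (Fin (1 + 2) → ℚ) × ℚ)
      (s₁ : KZ.IntegralRep (1 + 2 + 0)) (v : Fin (1 + 2) → ℚ), v (Fin.last (1 + 1)) ≠ 0 ∧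
      Bornology.IsBounded s₁.domain ∧
      s₁.domain = {z | (∀ j, 0 < ∑ i, ((M₁ j).1 i : ℝ) * z (Fin.castAdd 0 i) + ((M₁ j).2 : ℝ)) ∧
        ∀ i, Sum.elim (fun j => z (Fin.natAdd (1 + 2) j)) (fun c => ∑ i', (c.1 i' : ℝ) *
          z (Fin.castAdd 0 i') + (c.2 : ℝ)) (lo i) < z (Fin.natAdd (1 + 2) i) ∧
          z (Fin.natAdd (1 + 2) i) < Sum.elim (fun j => z (Fin.natAdd (1 + 2) j))
          (fun c => ∑ i', (c.1 i' : ℝ) * z (Fin.castAdd 0 i') + (c.2 : ℝ)) (hi i)} ∧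
      EqOn s₁.integrand (fun z => MvPolynomial.aeval (fun i => z (Fin.castAdd 0 i)) p /
        (∏ j, (∑ i, ((L j).1 i : ℝ) * z (Fin.castAdd 0 i) + ((L j).2 : ℝ)) ^ e j) *
        ∏ i, (a i).elim 1 (fun c => 1 / (z (Fin.natAdd (1 + 2) i) -
          (∑ i', (c.1 i' : ℝ) * z (Fin.castAdd 0 i') + (c.2 : ℝ))))) s₁.domain ∧
      s₁.domain ⊆ s.domain ∧
      (∀ j, e j ≠ 0 → (L j).1 ≠ 0 → (∑ i, (L j).1 i * v i) ≠ 0) ∧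
      (∀ j, (∑ i, (L j).1 i * v i) ≠ 0 → e j ≠ 0 → ∀ z ∈ s₁.domain,
        ∑ i, ((L j).1 i : ℝ) * z (Fin.castAdd 0 i) + ((L j).2 : ℝ) ≠ 0) ∧
      (∀ j j', (∑ i, (L j).1 i * v i) ≠ 0 → (∑ i, (L j').1 i * v i) ≠ 0 → e j ≠ 0 → e j' ≠ 0 →
        (∑ i, (L j').1 i * v i) • L j ≠ (∑ i, (L j).1 i * v i) • L j' →
        ∃ C : ℝ, ∀ z ∈ s₁.domain, |∑ i, ((L j').1 i : ℝ) * z (Fin.castAdd 0 i) + ((L j').2 : ℝ)| ≤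
          C * |(((∑ i, (L j).1 i * v i) : ℚ) : ℝ) * (∑ i, ((L j').1 i : ℝ) * z (Fin.castAdd 0 i) +
            ((L j').2 : ℝ)) - (((∑ i, (L j').1 i * v i) : ℚ) : ℝ) *
            (∑ i, ((L j).1 i : ℝ) * z (Fin.castAdd 0 i) + ((L j).2 : ℝ))|) ∧
      w = KZ.of s₁}, ∃ c' ∈ AddSubgroup.closure (GGset 2 1 0), w - c' ∈ KZ.relations by
    obtain ⟨c', hc', hcc⟩ := SepTwoZero.closure_transfer' hpiece c hc
    refine ⟨c', hc', ?_⟩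
    have := add_mem hrel hcc
    rwa [sub_add_sub_cancel] at this
  rintro w ⟨m₁, M₁, s₁, v, hv, hbd₁, hdom₁, hint₁, -, hactv, hpolev, hratv, rfl⟩
  -- the base change along `v`
  obtain ⟨hA', hA⟩ := dirAinv_mul_inv (n := 1 + 1) v hv
  obtain ⟨M', L', p', a', lo', hi', s', -, hL', -, -, -, -, hΨ, hbd', hdom', hint', hrel'⟩ :=
    separatePos_baseChange (1 + 2) 0 m m₁ s₁ M₁ L e p a lo hi hbd₁ hdom₁ hint₁ (dirAinv v)⁻¹
      (dirAinv v) hA hA'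
  have hform : ∀ j w, affF 2 0 (L' j) w =
      ∑ i, ((L j).1 i : ℝ) * (Fin.append (fun j => ∑ i, (dirAinv v j i : ℝ) * w (Fin.castAdd 0 i))
        (fun i => w (Fin.natAdd (1 + 2) i)) : Fin (1 + 2 + 0) → ℝ) (Fin.castAdd 0 i) +
        ((L j).2 : ℝ) := fun j w => by
    rw [hL']; exact (form_sub (dirAinv v) (L j) w).symm
  have hlast : ∀ j, (L' j).1 (Fin.last 2) = ∑ i, (L j).1 i * v i := fun j => by
    rw [hL']; exact vecMul_dirAinv_last _ _
  -- the cancellation induction on the transformed piece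
  have key : ∃ c' ∈ AddSubgroup.closure (GGset 2 1 0), KZ.of s' - c' ∈ KZ.relations := by
    refine SepThree.cancel hHI₃ s' M' L' a' lo' hi' hbd' hdom' _ e p' rfl hint'
      (fun j he hLj => ?_) (fun j hα he w hw => ?_) (fun j j' hα hα' he he' hne => ?_)
    · -- every active non-constant letter is a `y`-letter
      rw [hlast]
      refine hactv j he fun h0 => hLj ?_
      rw [hL', h0]
      simp
    · -- active `y`-letters do not vanish on the piece
      rw [hlast] at hα
      rw [hform]
      exact hpolev j hα he _ ((hΨ w).1 hw)
    · -- the ratio condition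
      rw [hlast] at hα hα'
      have hne' : (∑ i, (L j').1 i * v i) • L j ≠ (∑ i, (L j).1 i * v i) • L j' := fun h => by
        refine hne ?_
        rw [hlast, hlast, hL', hL']
        have h2 := congrArg (fun c : (Fin (1 + 2) → ℚ) × ℚ => (Matrix.vecMul c.1 (dirAinv v), c.2)) h
        simpa only [Prod.smul_fst, Prod.smul_snd, Matrix.smul_vecMul, Prod.smul_mk] using h2
      obtain ⟨C, hC⟩ := hratv j j' hα hα' he he' hne'
      refine ⟨C, fun w hw => ?_⟩
      have h := hC _ ((hΨ w).1 hw)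
      rw [hform, hform, hlast, hlast]
      exact h
  obtain ⟨c', hc', hr⟩ := key
  refine ⟨c', hc', ?_⟩
  have := add_mem hrel' hr
  rwa [sub_add_sub_cancel] at this

open SepThree in
/-- **Cancelling one power of a letter in the letter block** (registered sub-goal of
`stub_separateThreeZero`, part `Cancel`; the algebra of the cancellation step of
`SepThree.cancel`; the main theorems of this file, `SepThree.cancel` and
`separateThreeZero_of_hI3`, carry the long hypothesis `hHI₃`). -/
theorem separateThree_cancel (m : ℕ) (u : Fin m → ℝ) (e : Fin m → ℕ) (j : Fin m) (hj : e j ≠ 0) : ∏ i, u i ^ e i = u j * ∏ i, u i ^ Function.update e j (e j - 1) i :=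
  prod_pow_update u e j hj

end Summit.KontsevichZagierPeriods.ArrangementNormalForm.JanusBands
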